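import Mathlib.RingTheory.ZMod.UnitsCyclic
import Mathlib.GroupTheory.PGroup
import Mathlib.GroupTheory.Index
import HarnessLib

/-!
# The one-units of `ℤ/p^m`: the kernel of `(ℤ/p^{n+k})ˣ → (ℤ/p^k)ˣ` is a cyclic `p`-group
# (Ireland–Rosen Ch. 4 §1 Thms. 2, 2′; Serre, *Cours d'arithmétique* II §3)

Topic `NumberTheory/GaloisRepresentations` (finite levels of the one-units `1 + pℤ_p ⊂ ℤ_pˣ`, the
target of the cyclotomic character); namespace `Literature.NumberTheory.GaloisRepresentations`.
Theorems only (no definition, no named fact; D-0026).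

For a prime `p` and `k ≥ 1` let `K = ker((ℤ/p^{n+k})ˣ → (ℤ/p^k)ˣ)` (Mathlib `ZMod.unitsMap`), the
image of the one-units `1 + p^k ℤ_p` at level `p^{n+k}`.

* `card_ker_unitsMap_pow` — **`#K = p^n`** (the reduction is onto, `ZMod.unitsMap_surjective`, and
  `φ(p^{n+k}) = p^n φ(p^k)`);
* `isPGroup_ker_unitsMap_pow` — `K` is a `p`-group;
* `isCyclic_ker_unitsMap_pow_of_ne_two` — **`K` is cyclic for odd `p`** (a subgroup of the cyclic
  group `(ℤ/p^{n+k})ˣ`, Mathlib `ZMod.isCyclic_units_of_prime_pow`; Ireland–Rosen Thm. 2);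
* `isCyclic_ker_unitsMap_four` — **`ker((ℤ/2^{n+2})ˣ → (ℤ/4)ˣ)` is cyclic**, generated by `5`
  (Mathlib `ZMod.orderOf_five`: `5` has order `2^n` modulo `2^{n+2}`; Ireland–Rosen Thm. 2′).

So in all cases the finite quotients `(1 + qℤ_p)/(1 + p^m ℤ_p)` (`q = p` for odd `p`, `q = 4` for
`p = 2`) are CYCLIC `p`-GROUPS — the input "`Gal(k·ℚ_∞/k)` is pro-(cyclic `p`-group)" of the top
step of Serre, *Cohomologie galoisienne* II §4.4 Prop. 13 (`cd_p(G_k) ≤ 2` for number fields; the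
tree's `ProcyclicGenerator.groupCdLE_one_of_isCyclic_pGroup`).

## References

* K. Ireland, M. Rosen, *A Classical Introduction to Modern Number Theory*, 2nd ed. (1990), Ch. 4
  §1 Thms. 2, 2′ (structure of `U(ℤ/p^l ℤ)`). [IrelandRosen1990]
* J. Neukirch, *Algebraic Number Theory* (1999), Ch. II §5 Prop. (5.7) (one-units of `ℚ_p`).
  [NeukirchANT1999]
-/

noncomputable section

namespace Literature.NumberTheory.GaloisRepresentations

namespace ZModOneUnits

variable (p : ℕ) [hp : Fact p.Prime]

omit hp in
/-- `p ^ k ∣ p ^ (n + k)`. [folklore] -/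
private theorem pow_dvd_pow_add (k n : ℕ) : p ^ k ∣ p ^ (n + k) := pow_dvd_pow p (Nat.le_add_left k n)

/-- **`# ker((ℤ/p^{n+k+1})ˣ → (ℤ/p^{k+1})ˣ) = p^n`**: the reduction map is surjective
(`ZMod.unitsMap_surjective`) and `φ(p^{n+k+1}) = p^{n+k}(p-1) = p^n · φ(p^{k+1})`.
[cite: IrelandRosen1990, Ch. 4 §1 Thm. 2 (proof)] -/
theorem card_ker_unitsMap_pow (k n : ℕ) :
    Nat.card (ZMod.unitsMap (pow_dvd_pow_add p (k + 1) n)).ker = p ^ n := by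
  classical
  haveI : NeZero (p ^ (n + (k + 1))) := ⟨pow_ne_zero _ hp.out.ne_zero⟩
  haveI : NeZero (p ^ (k + 1)) := ⟨pow_ne_zero _ hp.out.ne_zero⟩
  set f := ZMod.unitsMap (pow_dvd_pow_add p (k + 1) n) with hf
  have hsurj : Function.Surjective f := ZMod.unitsMap_surjective _
  have h1 : Nat.card f.ker * f.ker.index = Nat.card (ZMod (p ^ (n + (k + 1))))ˣ :=
    Subgroup.card_mul_index _
  have h2 : f.ker.index = Nat.card (ZMod (p ^ (k + 1)))ˣ := by
    rw [Subgroup.index_ker, MonoidHom.range_eq_top.2 hsurj, Subgroup.card_top]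
  have hc1 : Nat.card (ZMod (p ^ (n + (k + 1))))ˣ = p ^ (n + k) * (p - 1) := by
    rw [Nat.card_eq_fintype_card, ZMod.card_units_eq_totient, show n + (k + 1) = (n + k) + 1 by ring,
      Nat.totient_prime_pow_succ hp.out]
  have hc2 : Nat.card (ZMod (p ^ (k + 1)))ˣ = p ^ k * (p - 1) := by
    rw [Nat.card_eq_fintype_card, ZMod.card_units_eq_totient, Nat.totient_prime_pow_succ hp.out]
  rw [h2, hc1, hc2, pow_add p n k, mul_assoc] at h1
  exact Nat.eq_of_mul_eq_mul_right
    (Nat.mul_pos (pow_pos hp.out.pos k) (Nat.sub_pos_of_lt hp.out.one_lt)) h1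

/-- **The kernel of `(ℤ/p^{n+k+1})ˣ → (ℤ/p^{k+1})ˣ` is a `p`-group** (of order `p^n`).
[cite: IrelandRosen1990, Ch. 4 §1 Thm. 2 (proof)] -/
theorem isPGroup_ker_unitsMap_pow (k n : ℕ) :
    IsPGroup p (ZMod.unitsMap (pow_dvd_pow_add p (k + 1) n)).ker :=
  IsPGroup.of_card (card_ker_unitsMap_pow p k n)

/-- **For odd `p` the kernel of `(ℤ/p^{n+k+1})ˣ → (ℤ/p^{k+1})ˣ` is cyclic** — a subgroup of the
cyclic group `(ℤ/p^{n+k+1})ˣ` (Mathlib `ZMod.isCyclic_units_of_prime_pow`).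
[cite: IrelandRosen1990, Ch. 4 §1 Thm. 2] -/
theorem isCyclic_ker_unitsMap_pow_of_ne_two (hp2 : p ≠ 2) (k n : ℕ) :
    IsCyclic (ZMod.unitsMap (pow_dvd_pow_add p (k + 1) n)).ker := by
  haveI := ZMod.isCyclic_units_of_prime_pow p hp.out hp2 (n + (k + 1))
  infer_instance

end ZModOneUnits

namespace ZModOneUnits

/-- **The kernel of `(ℤ/2^{n+2})ˣ → (ℤ/4)ˣ` is cyclic, generated by `5`**: `5 ≡ 1 (mod 4)` has
order `2^n` modulo `2^{n+2}` (Mathlib `ZMod.orderOf_five`), and the kernel has order `2^n`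
(`card_ker_unitsMap_pow`). [cite: IrelandRosen1990, Ch. 4 §1 Thm. 2′] -/
theorem isCyclic_ker_unitsMap_four (n : ℕ) :
    IsCyclic (ZMod.unitsMap (pow_dvd_pow_add 2 (1 + 1) n)).ker := by
  classical
  haveI : Fact (Nat.Prime 2) := ⟨Nat.prime_two⟩
  haveI : NeZero (2 ^ (n + (1 + 1))) := ⟨pow_ne_zero _ two_ne_zero⟩
  set f := ZMod.unitsMap (pow_dvd_pow_add 2 (1 + 1) n) with hf
  -- the unit `5` modulo `2^{n+2}`
  have h5cop : Nat.Coprime 5 (2 ^ (n + (1 + 1))) :=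
    Nat.Coprime.pow_right _ (by norm_num)
  set five : (ZMod (2 ^ (n + (1 + 1))))ˣ := ZMod.unitOfCoprime 5 h5cop with hfive
  have hfive_val : (five : ZMod (2 ^ (n + (1 + 1)))) = 5 := by
    rw [hfive, ZMod.coe_unitOfCoprime, Nat.cast_ofNat]
  -- `5 ≡ 1 (mod 4)`: `five ∈ ker f`
  have hmem : five ∈ f.ker := by
    rw [MonoidHom.mem_ker]
    apply Units.ext
    rw [Units.val_one, hf, ZMod.unitsMap_def, Units.coe_map, MonoidHom.coe_coe, hfive_val,
      map_ofNat]
    decide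
  -- its order is `2^n = # ker f`
  have hord : orderOf five = 2 ^ n := by
    rw [← orderOf_units, hfive_val, show n + (1 + 1) = n + 2 by ring]
    exact ZMod.orderOf_five n
  have hcard : Nat.card f.ker = 2 ^ n := card_ker_unitsMap_pow 2 1 n
  -- hence `ker f = ⟨5⟩`
  have heq : Subgroup.zpowers five = f.ker :=
    Subgroup.eq_of_le_of_card_ge ((Subgroup.zpowers_le).2 hmem) (by rw [hcard, Nat.card_zpowers, hord])
  rw [← heq]
  infer_instance

end ZModOneUnits

end Literature.NumberTheory.GaloisRepresentations

end
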